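import Summits.CriticalPhenomena.CardyFormulaZ2.Theses.CardySelfRefinement
import Summits.CriticalPhenomena.CardyFormulaZ2.Theorems.CardySelfRefinementScaleInvariantLimitsStubLagsOfNearIdentityGain
import Summits.CriticalPhenomena.CardyFormulaZ2.Theorems.CardySelfRefinementScaleInvariantLimitsStubScaleInvariantLimitsOfLags
import HarnessLib

/-!
# The near-identity gain implies the crux `ScaleInvariantLimits` (line `Sketch`, composition of
# the landed stubs B and C; stmt-CriticalPhenomena-10265)

The reduction achieved by line `Sketch` (card "marginal-three-arm-bootstrap") of the crux
`ScaleInvariantLimits` of route `CardySelfRefinement`, as ONE importable conditional theorem: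
**if the near-identity gain C⁺ holds on the lattice orbit** — for every finite family of quads `G`
and every `ε > 0` there is `τ₀ > 0` such that for all lags `0 < τ < τ₀` the joint crossing
probability `μ_δ {S | ∀ i, G i ∈ S}` (`μ_δ = squareCrossingLaw univ δ`, critical bond-`ℤ²`
percolation drawn at mesh `δ`) changes by at most `ε τ` between meshes `δ` and `(1 + τ) δ`, for all
small `δ` — **then every subsequential scaling limit `μ ∈ subseqQuadLimits univ` is invariant under
every dilation `S_t`, `t > 0`** (the crux, unfolded).  Proof: the lattice-orbit bootstrap
`stub_lags_of_nearIdentityGain` (C⁺ ⇒ merging of the laws at meshes `k η`, `η` on every joint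
crossing event, every `k > 1`) followed by `stub_scaleInvariantLimits_of_lags` (merging ⇒
invariance, through `dilateLaw_eq_self_of_lags`: soft SS11 Lemma 5.1 for one measure, Thm 1.4 (2),
Cor 5.2).  What remains of the crux on this line is exactly C⁺ (`stub_latticeNearIdentityGain`),
which `stub_nearIdentityGain_of_lags` shows to be EQUIVALENT, on the lattice, to asymptotic lag
invariance of the joint crossing probabilities.
-/

noncomputable section

open MeasureTheory Filter Set Topology
open Literature.Probability.Percolation Literature.Probability.Percolation.QuadCrossing

namespace Summit.CriticalPhenomena.CardyFormulaZ2.Theorems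

/-- **C⁺ ⇒ X (line `Sketch` closed modulo its stub A).**  If the near-identity gain holds on the
lattice orbit (hypothesis `hgain`, the registered signature of `stub_latticeNearIdentityGain`),
then every subsequential scaling limit `μ` of the critical bond-`ℤ²` quad-crossing laws satisfies
`dilateLaw t μ = μ` for every `t > 0` — i.e. `ScaleInvariantLimits` (unfolded).  Composition of
the landed `stub_lags_of_nearIdentityGain` and `stub_scaleInvariantLimits_of_lags`. -/
theorem stub_scaleInvariantLimits_of_nearIdentityGain
    (hgain : ∀ (m : ℕ) (G : Fin m → Quad (univ : Set ℂ)) (ε : ℝ), 0 < ε →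
      ∃ τ₀ : ℝ, 0 < τ₀ ∧ ∀ τ ∈ Ioo (0 : ℝ) τ₀, ∃ δ₀ : ℝ, 0 < δ₀ ∧ ∀ δ ∈ Ioo (0 : ℝ) δ₀,
        |(squareCrossingLaw (univ : Set ℂ) ((1 + τ) * δ) :
              Measure (QuadConfig (univ : Set ℂ))).real {S | ∀ i, G i ∈ S} -
          (squareCrossingLaw (univ : Set ℂ) δ : Measure (QuadConfig (univ : Set ℂ))).real
            {S | ∀ i, G i ∈ S}| ≤ ε * τ)
    (μ : FiniteMeasure (QuadConfig (univ : Set ℂ))) (hμ : μ ∈ subseqQuadLimits (univ : Set ℂ))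
    (t : ℝ) (ht : 0 < t) :
    dilateLaw t ht.ne' μ = μ :=
  stub_scaleInvariantLimits_of_lags
    (fun k hk m G => stub_lags_of_nearIdentityGain hgain k hk m G) μ hμ t ht

end Summit.CriticalPhenomena.CardyFormulaZ2.Theorems

end
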